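import Literature.NumberTheory.EllipticCurves.Rank1Residual.ClassX1KellerYinTypeA
import Literature.NumberTheory.EllipticCurves.QuadraticTwistProofs
import HarnessLib

/-!
# Class X1, rank one: the partner input reduced to Mazur's (MC) on the type-A anomalous locus

HONEST FRAMING (cell `b2b-bsdres`): the goal is to DELETE the COMBINATION-SHAPED residual classes of
the rank-`≤ 1` BSD formula over `ℚ` from PUBLISHED theorems only and to TYPE the rest; this is not
"finishing BSD". Fourth file of the Keller–Yin route for class X1 (audit
`b2b-bsdres-x1a/X1-CHAIN.md`). In `ClassX1KellerYinTypeA.lean` the rank-`0` input for the admissible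
twist `E^K` ("partner") was discharged from published facts when `E` is of parity type A. Here the
remaining case is reduced to the ONE typed missing input of the class: if `E` is of type B
(`GVPar W p`), its partner `E^K` (a global minimal model `Wd` of `E^{(d_K)}`) is either of type B as
well — then Greenberg–Vatsal applies to it directly — or of type A, and then `(Wd, p)` is itself a
class-X1 pair of type A with `ord_{s=1} L(E^K,s) = 0` (`E^K[p]` is reducible:
`not_hasIrreducibleModPGaloisRep_twist`; good ordinary at `p`: `isOrdinaryAt_of_smul_eq_quadraticTwist`;
anomalous: `a_p(E^K) = (d_K/p)·a_p(E) = a_p(E)` by `frobeniusTrace_quadraticTwist_holds` and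
`(d_K/p) = 1` for `p` split), so Mazur's (MC) for it is an instance of the typed input
"Mazur's main conjecture on X1 of type A" (`Rank1ResidualX1Defs.MazurMainConjectureOnX1TypeA`,
here the inline hypothesis `hA`).

Consequence (`bsdp_of_classX1_of_analyticRank_eq_one_of_KY_OPEN_of_mazurMC_typeA`): on ALL of
X1 ∩ {r = 1}, Miller's `BSD(E,p)` follows from PUBLISHED named facts (Greenberg–Vatsal 2000 Thm. 1.3,
Greenberg 1999 Thm. 4.1, modularity, Hoffstein–Luo 1997, Gross–Zagier 1986 I.7.3,
Gross–Zagier–Kolyvagin, the twisting formula for `a_p`) and exactly TWO open hypotheses: Keller–Yin's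
rank-one display (`hKY_OPEN`; KY Thms. 3.0.11 + 7.0.6, preprint) and Mazur's (MC) on the type-A
anomalous locus (`hA`; unstated in print). Together with the rank-`0` theorem this makes the whole
class X1 rest on those two named statements (assembled Summits-side as
`Rank1ResidualX1Defs.bsdpOnClassX1_of_typedInputs'`).

References: [KellerYin2024] Thm. 4.2.1; [CastellaEtAl2021] Thms. 5.1.4, 5.3.1;
[GreenbergVatsal2000] Thm. (1.3); [Knapp1993] Prop. 12.10 (twisting formula).
-/

set_option autoImplicit false

noncomputable section

open scoped Classical MatrixGroups ModularForm

open CongruenceSubgroup WeierstrassCurve Literature.NumberTheory.EllipticCurves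
  Literature.NumberTheory.EllipticCurves.ModularForms

namespace Literature.NumberTheory.EllipticCurves.Rank1Residual

/-- **The partner input from Greenberg–Vatsal OR the typed type-A input.** For `W/ℚ` globally
minimal elliptic, a class-X1 prime `p`, an admissible field `K` (imaginary quadratic, `d_K` odd, `p`
split, `L(E^K,1) ≠ 0`) and a global minimal model `Wd` of `E^{(d_K)}`: the rank-`0` print shape
`PPartRankZero Wd p` holds, given the published named facts (`hGV` Greenberg–Vatsal, `hGr` Greenberg
Thm. 4.1, `hmodP` modularity, `hGZK` Gross–Zagier–Kolyvagin) and the hypothesis `hA` = Mazur's (MC)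
for every class-X1 pair of parity type A (the body of `Rank1ResidualX1Defs.MazurMainConjectureOnX1TypeA`):
if `GVPar Wd p`, Greenberg–Vatsal gives (MC) for `(Wd,p)`; otherwise `(Wd,p)` is a class-X1 pair of
type A (`E^K[p]` reducible, good ordinary and anomalous at `p` by the twisting formula with
`(d_K/p) = 1`) with `r_an = 0`, and `hA` gives it. [cite: CastellaEtAl2021, Thm. 5.1.4 and proof of Thm. 5.3.1]
[cite: GreenbergVatsal2000, Thm. (1.3)] [cite: Knapp1993, Prop. 12.10] -/
theorem pPartRankZero_twist_of_mazurMC_typeA (hGV : GreenbergVatsal2000.thm13_charIdeal_eq_of_gvPar)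
    (hGr : greenberg_charValue_rankZero) (hmodP : nonempty_modularParametrizationData)
    (hGZK : rank_eq_analyticRank_of_analyticRank_le_one)
    (hA : ∀ (W' : WeierstrassCurve ℚ) [W'.IsElliptic] [W'.IsGloballyMinimal] (p' : ℕ) [Fact p'.Prime],
      ClassX1 W' p' → ¬ GVPar W' p' →
      ∀ (κ : ZpExtension ℚ p') (γ : Field.absoluteGaloisGroup ℚ),
          κ.IsCyclotomic → κ.IsTopGenerator γ → IsCyclotomicVariable p' γ →
        ∀ [NeZero (W'.conductorNorm ℤ)] (f : CuspForm (Gamma0 (W'.conductorNorm ℤ)) 2),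
          IsNewformOf W' f → ∀ (ϖ : ℚ), (ϖ : ℝ) * W'.realPeriodRat = plusPeriod f →
        ∀ (D : W'.SelmerDualData κ γ), D.IsTorsion ∧
          ∃ g : IwasawaAlgebra p', D.charIdeal = Ideal.span {g} ∧
            iwasawaToPowerSeries p' g =
              PowerSeries.C (ϖ : ℚ_[p']) * padicLFunction f (unitRoot W' p' : ℚ_[p']))
    (W : WeierstrassCurve ℚ) [W.IsElliptic] [W.IsGloballyMinimal] (p : ℕ) [Fact p.Prime]
    (hX1 : ClassX1 W p)
    (K : Type) [Field K] [NumberField K] (hK : IsImaginaryQuadratic K)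
    (hodd : Odd (NumberField.discr K)) (hsplit : SatisfiesHeegnerHypothesis p K)
    (hLK : (W.quadraticTwist (NumberField.discr K : ℚ)).entireLFunction 1 ≠ 0)
    (Wd : WeierstrassCurve ℚ) [Wd.IsElliptic] [Wd.IsGloballyMinimal]
    (hWd : ∃ C : VariableChange ℚ, C • Wd = W.quadraticTwist (NumberField.discr K : ℚ)) :
    PPartRankZero Wd p := by
  have hp : p.Prime := Fact.out
  have hp2 : p ≠ 2 := by have := hX1.1; omega
  have hgood : W.HasGoodReductionAtPrime p := hX1.2.2.1
  have hred : ¬ W.HasIrreducibleModPGaloisRep p := hX1.2.1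
  have hanom : (p : ℤ) ∣ W.frobeniusTrace p - 1 := hX1.2.2.2.1.2.2
  have hord : ¬ (p : ℤ) ∣ W.frobeniusTrace p :=
    KellerYin2024.not_dvd_frobeniusTrace_of_anomalous W p hanom
  obtain ⟨C, hC⟩ := hWd
  have hdneg : NumberField.discr K < 0 := IsImaginaryQuadratic.discr_neg hK
  have hd0 : (NumberField.discr K : ℚ) ≠ 0 := by exact_mod_cast hdneg.ne
  have hsqf : Squarefree (NumberField.discr K) := squarefree_discr_of_odd hK hodd
  have hpd : ¬ (p : ℤ) ∣ NumberField.discr K := not_dvd_discr_of_split hK hp hp2 hsplit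
  obtain ⟨hgood_d, hord_d⟩ :=
    isOrdinaryAt_of_smul_eq_quadraticTwist W Wd hsqf hC p hp2 hpd ⟨hgood, hord⟩
  have hLd : Wd.entireLFunction 1 ≠ 0 := by
    rw [← Wd.entireLFunction_smul C, hC]
    exact hLK
  have hrd : Wd.analyticRank = 0 := analyticRank_eq_zero_of_entireLFunction_one_ne_zero hLd
  obtain ⟨-, hfin_d⟩ := hGZK Wd (by omega)
  have hGr_d := fun (κ : ZpExtension ℚ p) (γ : Field.absoluteGaloisGroup ℚ) (hκ : κ.IsCyclotomic)
      (hγ : κ.IsTopGenerator γ) (hγ' : IsCyclotomicVariable p γ) (D : Wd.SelmerDualData κ γ)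
      (_ : Module.Finite (IwasawaAlgebra p) D.X) (hX : D.IsTorsion) (fE : IwasawaAlgebra p)
      (hfE : D.charIdeal = Ideal.span {fE}) (hSel : Finite (Wd.selmerGroupPInfty p)) ↦
    hGr Wd p hp2 hgood_d hord_d κ γ hκ hγ hγ' D hX fE hfE hSel
  by_cases hpar_d : GVPar Wd p
  · -- the partner is of type B: Greenberg–Vatsal
    exact padicValRat_bsd_rank_zero_of_mazurMainConjecture Wd p hgood_d hord_d hLd hfin_d hmodP
      hGr_d (hGV Wd p hp2 hgood_d hord_d hpar_d)
  · -- the partner is of type A: it is a class-X1 pair with `r_an = 0`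
    have hred_d : ¬ Wd.HasIrreducibleModPGaloisRep p :=
      not_hasIrreducibleModPGaloisRep_twist hred hd0 Wd C hC
    have hanom_d : (p : ℤ) ∣ Wd.frobeniusTrace p - 1 := by
      have hj : jacobiSym (NumberField.discr K) p = 1 :=
        ((satisfiesHeegnerHypothesis_iff_kronecker p K hK.1).mp hsplit p hp dvd_rfl).2 hp2
      have hp2d : ¬ (p : ℤ) ∣ 2 * NumberField.discr K := by
        intro h
        rcases (Nat.prime_iff_prime_int.mp hp).dvd_or_dvd h with h2 | h2
        · have := Int.le_of_dvd two_pos h2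
          have h1 := hp.two_le
          have : (p : ℤ) = 2 := by omega
          exact hp2 (by exact_mod_cast this)
        · exact hpd h2
      have hΔ : ¬ (p : ℤ) ∣ W.minimalDiscriminantInt :=
        W.not_dvd_minimalDiscriminantInt_of_hasGoodReductionAtPrime' p hgood
      have htw := frobeniusTrace_quadraticTwist_holds W Wd (NumberField.discr K) hsqf ⟨C, hC⟩ p
        hp2d hΔ
      rw [jacobiSym.legendreSym.to_jacobiSym, hj, one_mul] at htw
      rw [htw]
      exact hanom
    have hX1d : ClassX1 Wd p :=
      ⟨hX1.1, hred_d, hgood_d, ⟨hred_d, hgood_d, hanom_d⟩, fun h ↦ hpar_d h.2⟩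
    exact padicValRat_bsd_rank_zero_of_mazurMainConjecture Wd p hgood_d hord_d hLd hfin_d hmodP
      hGr_d (hA Wd p hX1d hpar_d)

/-- **X1 ∩ {r = 1} (both parity types) ⇒ `BSD(E,p)` modulo Keller–Yin's rank-one display and
Mazur's (MC) on the type-A anomalous locus.** For `W/ℚ` globally minimal elliptic, `ClassX1 W p`,
`ord_{s=1} L(E,s) = 1`: Miller's `BSD(E,p)` follows from the PUBLISHED named facts
(`GreenbergVatsal2000.thm13_charIdeal_eq_of_gvPar`, `greenberg_charValue_rankZero`,
`nonempty_modularParametrizationData`, `exists_isNewformOf`, `HoffsteinLuo1997_exists_twist_L_one_ne_zero`,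
`GrossZagier1986_thm_I_7_3`, `rank_eq_analyticRank_of_analyticRank_le_one`, and the discharged
twisting formula) and TWO open hypotheses: `hKY_OPEN` (Keller–Yin's rank-one display, `∀`-form of
`KellerYin2024.thm421_rankOne_display_OPEN`: KY Thms. 3.0.11 + 7.0.6, PREPRINT) and `hA` (Mazur's
(MC) for every class-X1 pair of parity type A — NOT in print and not stated by Keller–Yin; used only
when the partner `E^K` is of type A, i.e. when `E` is of type B).
[cite: KellerYin2024, Thm. 4.2.1 and its proof (p. 22)] [cite: CastellaEtAl2021, Thms. 5.1.4, 5.3.1] -/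
theorem bsdp_of_classX1_of_analyticRank_eq_one_of_KY_OPEN_of_mazurMC_typeA
    (hGV : GreenbergVatsal2000.thm13_charIdeal_eq_of_gvPar) (hGr : greenberg_charValue_rankZero)
    (hmodP : nonempty_modularParametrizationData) (hmod : exists_isNewformOf)
    (hHL : HoffsteinLuo1997_exists_twist_L_one_ne_zero) (hGZ : GrossZagier1986_thm_I_7_3)
    (hGZK : rank_eq_analyticRank_of_analyticRank_le_one)
    (hKY_OPEN : ∀ (W' : WeierstrassCurve ℚ) [W'.IsElliptic] [W'.IsGloballyMinimal] (p' : ℕ)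
        [Fact p'.Prime], p' ≠ 2 → W'.HasGoodReductionAtPrime p' → ¬ W'.HasIrreducibleModPGaloisRep p' →
        W'.analyticRank = 1 →
      ∀ (K : Type) [Field K] [NumberField K], IsImaginaryQuadratic K →
        Odd (NumberField.discr K) → NumberField.discr K < -4 →
        SatisfiesHeegnerHypothesis (W'.conductorNorm ℤ) K → SatisfiesHeegnerHypothesis p' K →
        (W'.quadraticTwist (NumberField.discr K : ℚ)).entireLFunction 1 ≠ 0 →
      ∀ (Wd : WeierstrassCurve ℚ) [Wd.IsElliptic] [Wd.IsGloballyMinimal],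
        (∃ C : VariableChange ℚ, C • Wd = W'.quadraticTwist (NumberField.discr K : ℚ)) →
      ∀ (q qd : ℚ), W'.leadingLCoeff / ((W'.realPeriodRat * W'.regulator : ℝ) : ℂ) = (q : ℂ) →
        Wd.entireLFunction 1 / (Wd.realPeriodRat : ℂ) = (qd : ℂ) →
        padicValRat p' q - ((padicValNat p' W'.shaOrder : ℤ) + padicValNat p' W'.tamagawaProduct -
            2 * padicValNat p' W'.torsionOrder) =
          -(padicValRat p' qd - ((padicValNat p' Wd.shaOrder : ℤ) + padicValNat p' Wd.tamagawaProduct -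
            2 * padicValNat p' Wd.torsionOrder)))
    (hA : ∀ (W' : WeierstrassCurve ℚ) [W'.IsElliptic] [W'.IsGloballyMinimal] (p' : ℕ) [Fact p'.Prime],
      ClassX1 W' p' → ¬ GVPar W' p' →
      ∀ (κ : ZpExtension ℚ p') (γ : Field.absoluteGaloisGroup ℚ),
          κ.IsCyclotomic → κ.IsTopGenerator γ → IsCyclotomicVariable p' γ →
        ∀ [NeZero (W'.conductorNorm ℤ)] (f : CuspForm (Gamma0 (W'.conductorNorm ℤ)) 2),
          IsNewformOf W' f → ∀ (ϖ : ℚ), (ϖ : ℝ) * W'.realPeriodRat = plusPeriod f →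
        ∀ (D : W'.SelmerDualData κ γ), D.IsTorsion ∧
          ∃ g : IwasawaAlgebra p', D.charIdeal = Ideal.span {g} ∧
            iwasawaToPowerSeries p' g =
              PowerSeries.C (ϖ : ℚ_[p']) * padicLFunction f (unitRoot W' p' : ℚ_[p']))
    (W : WeierstrassCurve ℚ) [W.IsElliptic] [W.IsGloballyMinimal] (p : ℕ) [Fact p.Prime]
    (hX1 : ClassX1 W p) (hr : W.analyticRank = 1) : BSDp W p :=
  bsdp_of_classX1_of_analyticRank_eq_one_of_KY_OPEN W p hX1 hr hmod hHL hGZ hGZK hKY_OPEN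
    (fun K _ _ hK hodd _ _ hsplit hLK Wd _ _ hWd _ ↦
      pPartRankZero_twist_of_mazurMC_typeA hGV hGr hmodP hGZK hA W p hX1 K hK hodd hsplit hLK Wd hWd)

end Literature.NumberTheory.EllipticCurves.Rank1Residual

end
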